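import Summits.BirchSwinnertonDyer.BirchSwinnertonDyer.Theorems.KolyvaginRoadThreeSchneiderTamAtThreeHeightLogNumeratorLargePrimeSeries
import Summits.BirchSwinnertonDyer.BirchSwinnertonDyer.Theorems.ClassRecordThreeRegCertKernelO3FormalLog
import HarnessLib

/-!
# «The height is the logarithm of the numerator» — the EXACT second-order law at EVERY multiplicative
# prime `p ≥ 5`, part 1a: the formal logarithm to its quintic term (generic `p`)

HONEST FRAMING (cell `bsd-stepL`, seat `bsd-stepL-tam3-p2` g5, WIDTH-LEVER second lane «closed-form Schneider
local factor … by Kodaira type (finite case table proved once)»; `--supports stmt-BirchSwinnertonDyer-19154 --as helper`):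
THEOREMS ONLY, unconditional, route-independent (no Theses import); 0 definitions, 0 named facts, 0 sorry;
nothing here proves the crux `SchneiderTamAtThree`, Schneider's conjecture or BSD. This is the `p ≥ 5` twin of the
`p = 3` chain's series parts (`…DeepSeries`, seat g2): at `p ≥ 5` the exact law
`‖ĥ_p(P) − log_p num x + κ_E·den x/num x‖_p ≤ ‖x‖_p⁻²` holds from LEVEL ONE (`‖z‖ ≤ p⁻¹`), which needs the formal
logarithm one degree further than anything in the tree (the `z⁵` coefficient carries the `1/5` that cancels the `1/5` of
the `℘`-expansion's `c₄/240` at `p = 5`):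

* §1 (any commutative ring) `coeff_seven_formalW = a₁⁴ + 3a₁²a₂ + a₂² + 3a₁a₃ + a₄`, `coeff_four_formalWDivCube`;
* §2 (any `ℚ`-algebra) `coeff_four_formalOmega = a₁⁴ + 3a₁²a₂ + a₂² + 6a₁a₃ + 2a₄` (degree `4` of the tree's identity
  `formalOmega_mul_denom : ω·B(2 − a₁z − a₃z³B) = 2B + zB′`), `coeff_five_formalLog = (…)/5`;
* §3 (`ℚ_p`, `p ≥ 5`, `p`-integral equation) `norm_padicFormalLog_sub_quintic_le_padic` —
  `‖log_W(z) − (z + ½a₁z² + ⅓(a₁²+a₂)z³ + ¼(a₁³+2a₁a₂+2a₃)z⁴ + ⅕(a₁⁴+3a₁²a₂+a₂²+6a₁a₃+2a₄)z⁵)‖_p ≤ ‖z‖⁶` on `‖z‖ ≤ p⁻¹`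
  (terms `n ≥ 6`: `v_p(n) ≤ n − 6`).

References: [SilvermanAEC2009] IV.1.1, IV.5.5, IV.6.3–6.4; tree: lane A `…Rung62310y1HeightEvalFormalLog` (degrees `≤ 5`
of `w`, `≤ 2` of `ω`), `…RegCertKernelO3FormalLog` (`coeff 6 w`, `coeff 3 ω`, `coeff 4 log_W`), g0 `…LargePrimeSeries`
(`norm_coeff_formalLog_le_norm_inv_padic`).
-/

noncomputable section

open scoped Classical Nat
open Filter Topology IsUltrametricDist PowerSeries
open WeierstrassCurve Literature.NumberTheory.EllipticCurves
open Literature.NumberTheory.EllipticCurves.SteinWuthrich2013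
open Summit.BirchSwinnertonDyer.Uniform.UI.O2
open Summit.BirchSwinnertonDyer.Rank1Residual.X11b.RegMult.Rung62310y1
open Summit.BirchSwinnertonDyer.Rank1Residual.X11b.RegMult.KernelCert

namespace Summit.BirchSwinnertonDyer.Rank1Residual.X11b.RegMult.HeightLogNumerator

/-! ### §1 `coeff 7 w(z) = a₁⁴ + 3a₁²a₂ + a₂² + 3a₁a₃ + a₄` -/

section Ring

variable {R : Type*} [CommRing R] (W : WeierstrassCurve R)

/-- The iterates `fᵐ(0)` have `coeff 7 = a₁⁴ + 3a₁²a₂ + a₂² + 3a₁a₃ + a₄` for `m ≥ 4`. [Silverman AEC IV.1.1(a)]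
[cite: SilvermanAEC2009, IV.1.1] -/
theorem coeff_seven_iterate_formalWStep (m : ℕ) (hm : 4 ≤ m) :
    coeff 7 ((W.formalWStep)^[m + 1] 0) =
      W.a₁ ^ 4 + 3 * W.a₁ ^ 2 * W.a₂ + W.a₂ ^ 2 + 3 * W.a₁ * W.a₃ + W.a₄ := by
  obtain ⟨k, rfl⟩ : ∃ k, m = k + 1 := ⟨m - 1, by omega⟩
  obtain ⟨h3, h4, h5⟩ := coeff_iterate_formalWStep W k
  have h6 := coeff_six_iterate_formalWStep W k (by omega)
  obtain ⟨u, hu⟩ := W.X_pow_three_dvd_iterate_formalWStep (k + 1)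
  have hu0 : coeff 0 u = 1 := by
    have := h3; rw [hu, coeff_X_pow_mul'] at this; simpa using this
  have hu1 : coeff 1 u = W.a₁ := by
    have := h4 (by omega); rw [hu, coeff_X_pow_mul'] at this; simpa using this
  have hu2 : coeff 2 u = W.a₁ ^ 2 + W.a₂ := by
    have := h5 (by omega); rw [hu, coeff_X_pow_mul'] at this; simpa using this
  have hu3 : coeff 3 u = W.a₁ ^ 3 + 2 * W.a₁ * W.a₂ + W.a₃ := by
    have := h6; rw [hu, coeff_X_pow_mul'] at this; simpa using this
  have hstep : (W.formalWStep)^[k + 1 + 1] 0 = W.formalWStep (X ^ 3 * u) := by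
    rw [Function.iterate_succ_apply', hu]
  rw [hstep, W.formalWStep_X_pow_mul, map_add, coeff_X_pow_mul', coeff_X_pow]
  simp only [show ¬ (7 : ℕ) = 3 by norm_num, if_false, show (4 : ℕ) ≤ 7 by norm_num, if_true, zero_add,
    show (7 : ℕ) - 4 = 3 by norm_num, map_add, mul_assoc, coeff_C_mul, coeff_succ_X_mul, coeff_X_pow_mul']
  have hsq0 : coeff 0 (u ^ 2) = 1 := by rw [pow_two, PowerSeries.coeff_mul]; simp [hu0]
  have hsq1 : coeff 1 (u ^ 2) = 2 * W.a₁ := by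
    rw [pow_two, PowerSeries.coeff_mul, Finset.Nat.sum_antidiagonal_succ]
    simp [hu0, hu1]; ring
  simp [hu2, hu3, hsq0, hsq1]
  ring

/-- `coeff 7 w(z) = a₁⁴ + 3a₁²a₂ + a₂² + 3a₁a₃ + a₄`. [Silverman AEC IV.1.1(a)] [cite: SilvermanAEC2009, IV.1.1] -/
theorem coeff_seven_formalW :
    coeff 7 W.formalW = W.a₁ ^ 4 + 3 * W.a₁ ^ 2 * W.a₂ + W.a₂ ^ 2 + 3 * W.a₁ * W.a₃ + W.a₄ := by
  rw [WeierstrassCurve.formalW, coeff_mk]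
  exact coeff_seven_iterate_formalWStep W 6 (by norm_num)

/-- `coeff 4 B = a₁⁴ + 3a₁²a₂ + a₂² + 3a₁a₃ + a₄` for `B = w/z³`. [Silverman AEC IV.1.1(a)]
[cite: SilvermanAEC2009, IV.1.1] -/
theorem coeff_four_formalWDivCube :
    coeff 4 W.formalWDivCube = W.a₁ ^ 4 + 3 * W.a₁ ^ 2 * W.a₂ + W.a₂ ^ 2 + 3 * W.a₁ * W.a₃ + W.a₄ := by
  rw [WeierstrassCurve.formalWDivCube, coeff_mk]; exact coeff_seven_formalW W

end Ring

/-! ### §2 `coeff 4 ω = a₁⁴ + 3a₁²a₂ + a₂² + 6a₁a₃ + 2a₄` and `coeff 5 log_W` -/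

section RatAlgebra

variable {A : Type*} [CommRing A] [Algebra ℚ A] (W : WeierstrassCurve A)

omit [Algebra ℚ A] in
/-- Coefficients `0 … 4` of the denominator `D = B·(2 − a₁z − a₃z³B)` of `ω`:
`2, a₁, a₁² + 2a₂, a₁³ + 3a₁a₂ + a₃, a₁⁴ + 4a₁²a₂ + 2a₂² + 3a₁a₃ + 2a₄`. [folklore] -/
private theorem coeff_formalOmegaDenom₄ :
    coeff 0 (W.formalWDivCube * (2 - C W.a₁ * X - C W.a₃ * X ^ 3 * W.formalWDivCube)) = 2 ∧
    coeff 1 (W.formalWDivCube * (2 - C W.a₁ * X - C W.a₃ * X ^ 3 * W.formalWDivCube)) = W.a₁ ∧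
    coeff 2 (W.formalWDivCube * (2 - C W.a₁ * X - C W.a₃ * X ^ 3 * W.formalWDivCube)) = W.a₁ ^ 2 + 2 * W.a₂ ∧
    coeff 3 (W.formalWDivCube * (2 - C W.a₁ * X - C W.a₃ * X ^ 3 * W.formalWDivCube)) =
      W.a₁ ^ 3 + 3 * W.a₁ * W.a₂ + W.a₃ ∧
    coeff 4 (W.formalWDivCube * (2 - C W.a₁ * X - C W.a₃ * X ^ 3 * W.formalWDivCube)) =
      W.a₁ ^ 4 + 4 * W.a₁ ^ 2 * W.a₂ + 2 * W.a₂ ^ 2 + 3 * W.a₁ * W.a₃ + 2 * W.a₄ := by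
  have hD : W.formalWDivCube * (2 - C W.a₁ * X - C W.a₃ * X ^ 3 * W.formalWDivCube) =
      C (2 : A) * W.formalWDivCube - C W.a₁ * (X * W.formalWDivCube) -
        C W.a₃ * (X ^ 3 * (W.formalWDivCube * W.formalWDivCube)) := by
    rw [map_ofNat]; ring
  have h0 : coeff 0 W.formalWDivCube = 1 := by
    rw [coeff_zero_eq_constantCoeff]; exact W.constantCoeff_formalWDivCube
  have hsq : coeff 0 (W.formalWDivCube * W.formalWDivCube) = 1 := by
    rw [PowerSeries.coeff_mul]; simp [h0]
  have hsq1 : coeff 1 (W.formalWDivCube * W.formalWDivCube) = 2 * W.a₁ := by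
    rw [PowerSeries.coeff_mul, Finset.Nat.sum_antidiagonal_succ]
    simp [h0, (coeff_one_formalWDivCube W)]; ring
  rw [hD]
  refine ⟨?_, ?_, ?_, ?_, ?_⟩
  · simp only [map_sub, coeff_C_mul, coeff_zero_X_mul, coeff_X_pow_mul', h0]; simp
  · simp only [map_sub, coeff_C_mul, coeff_succ_X_mul, coeff_X_pow_mul', h0, (coeff_one_formalWDivCube W)]
    simp; ring
  · simp only [map_sub, coeff_C_mul, coeff_succ_X_mul, coeff_X_pow_mul', (coeff_one_formalWDivCube W),
      (coeff_two_formalWDivCube W)]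
    simp; ring
  · simp only [map_sub, coeff_C_mul, coeff_succ_X_mul, coeff_X_pow_mul', (coeff_two_formalWDivCube W),
      (coeff_three_formalWDivCube W), hsq]
    simp; ring
  · simp only [map_sub, coeff_C_mul, coeff_succ_X_mul, coeff_X_pow_mul', (coeff_three_formalWDivCube W),
      (coeff_four_formalWDivCube W), hsq1]
    simp; ring

/-- **`coeff 4 ω = a₁⁴ + 3a₁²a₂ + a₂² + 6a₁a₃ + 2a₄`** (degree-4 coefficients in `ω·D = 2B + zB′`).
[Silverman AEC IV.1] [cite: SilvermanAEC2009, IV.1.1] -/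
theorem coeff_four_formalOmega :
    coeff 4 W.formalOmega = W.a₁ ^ 4 + 3 * W.a₁ ^ 2 * W.a₂ + W.a₂ ^ 2 + 6 * W.a₁ * W.a₃ + 2 * W.a₄ := by
  have h := congrArg (coeff 4) W.formalOmega_mul_denom
  obtain ⟨d0, d1, d2, d3, d4⟩ := coeff_formalOmegaDenom₄ W
  have hω0 : coeff 0 W.formalOmega = 1 := by
    rw [coeff_zero_eq_constantCoeff]; exact W.constantCoeff_formalOmega
  have hω1 := coeff_one_formalOmega W
  have hω2 := coeff_two_formalOmega W
  have hω3 := coeff_three_formalOmega W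
  rw [PowerSeries.coeff_mul, Finset.Nat.sum_antidiagonal_succ, Finset.Nat.sum_antidiagonal_succ,
    Finset.Nat.sum_antidiagonal_succ, Finset.Nat.sum_antidiagonal_succ] at h
  simp only [Finset.Nat.antidiagonal_zero, Finset.sum_singleton, zero_add] at h
  rw [hω0, hω1, hω2, hω3, d4, d3, d2, d1, d0, map_add,
    show (2 : A⟦X⟧) * W.formalWDivCube = C (2 : A) * W.formalWDivCube by rw [map_ofNat], coeff_C_mul,
    (coeff_four_formalWDivCube W), coeff_succ_X_mul, coeff_derivative, (coeff_four_formalWDivCube W)] at h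
  have h2 : IsUnit (2 : A) := ⟨WeierstrassCurve.unitTwo, rfl⟩
  refine h2.mul_left_cancel ?_
  have : (2 : A) * coeff 4 W.formalOmega = coeff 4 W.formalOmega * 2 := mul_comm _ _
  rw [this]
  push_cast at h
  linear_combination h

/-- **`coeff 5 log_W = (a₁⁴ + 3a₁²a₂ + a₂² + 6a₁a₃ + 2a₄)/5`** (`log_W = ∫ ω`). [Silverman AEC IV.5.5]
[cite: SilvermanAEC2009, IV.5.5] -/
theorem coeff_five_formalLog :
    coeff 5 W.formalLog =
      algebraMap ℚ A (1 / 5) * (W.a₁ ^ 4 + 3 * W.a₁ ^ 2 * W.a₂ + W.a₂ ^ 2 + 6 * W.a₁ * W.a₃ + 2 * W.a₄) := by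
  rw [WeierstrassCurve.formalLog, coeff_mk]
  show algebraMap ℚ A (1 / ((3 : ℕ) + 2 : ℚ)) * coeff (3 + 1) W.formalOmega = _
  rw [coeff_four_formalOmega W]; norm_num

end RatAlgebra

variable {p : ℕ} [hp : Fact p.Prime]

/-! ### §3 The formal logarithm to its quintic term at `p ≥ 5`: error `‖z‖⁶` on `‖z‖ ≤ p⁻¹` -/

section FormalLog

variable (V : WeierstrassCurve ℚ_[p]) [V.IsIntegral ℤ_[p]]

omit hp in
/-- `5^{n+2} > n + 7`. [folklore] -/
private theorem five_pow_add_two_gt_add_seven (n : ℕ) : n + 7 < 5 ^ (n + 2) := by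
  induction n with
  | zero => norm_num
  | succ k ih => rw [pow_succ]; omega

/-- `v_p(n + 6) ≤ n` for `p ≥ 5`. [folklore] -/
private theorem padicValNat_add_six_le (hp5 : 5 ≤ p) (n : ℕ) : padicValNat p (n + 6) ≤ n := by
  rcases Nat.eq_zero_or_pos n with rfl | hn
  · -- `p ∤ 6` for `p ≥ 5`
    rw [Nat.le_zero, padicValNat.eq_zero_iff]
    right; right
    intro h
    have h6 : p ≤ 6 := Nat.le_of_dvd (by norm_num) h
    interval_cases p
    · norm_num at h
    · exact absurd hp.out (by norm_num)
  · obtain ⟨m, rfl⟩ : ∃ m, n = m + 1 := ⟨n - 1, by omega⟩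
    have hdvd : p ^ padicValNat p (m + 1 + 6) ∣ m + 1 + 6 := pow_padicValNat_dvd
    have hle : p ^ padicValNat p (m + 1 + 6) ≤ m + 1 + 6 := Nat.le_of_dvd (by omega) hdvd
    by_contra hgt
    have hge : m + 2 ≤ padicValNat p (m + 1 + 6) := by omega
    have h1 : 5 ^ (m + 2) ≤ p ^ (m + 2) := Nat.pow_le_pow_left hp5 _
    have h2 : p ^ (m + 2) ≤ p ^ padicValNat p (m + 1 + 6) := Nat.pow_le_pow_right hp.out.pos hge
    have := five_pow_add_two_gt_add_seven m
    omega

/-- `‖1/(n+6)‖_p ≤ pⁿ` for `p ≥ 5`. [folklore] -/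
private theorem norm_inv_natCast_add_six_le_padic (hp5 : 5 ≤ p) (n : ℕ) :
    ‖(((n + 6 : ℕ) : ℚ_[p]))⁻¹‖ ≤ (p : ℝ) ^ n := by
  have hp1 : (1 : ℝ) ≤ p := by exact_mod_cast hp.out.one_lt.le
  rw [norm_inv, Padic.norm_eq_zpow_neg_valuation (by exact_mod_cast (show (n + 6 : ℕ) ≠ 0 by omega)),
    Padic.valuation_natCast, zpow_neg, inv_inv, zpow_natCast]
  exact pow_le_pow_right₀ hp1 (padicValNat_add_six_le hp5 n)

/-- The terms of degree `n + 6` of `log_W(z)` have norm `≤ ‖z‖⁶` when `‖z‖_p ≤ p⁻¹`, `p ≥ 5`.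
[cite: SilvermanAEC2009, IV.6.3] -/
private theorem norm_formalLog_term_le_pow_six_padic (hp5 : 5 ≤ p) {z : ℚ_[p]} (hz : ‖z‖ ≤ (p : ℝ)⁻¹)
    (n : ℕ) : ‖coeff (n + 6) V.formalLog * z ^ (n + 6)‖ ≤ ‖z‖ ^ 6 := by
  have hp0 : (0 : ℝ) < p := by exact_mod_cast hp.out.pos
  rw [norm_mul, norm_pow]
  have hc := norm_coeff_formalLog_le_norm_inv_padic V (n + 4)
  rw [show n + 4 + 2 = n + 6 by ring] at hc
  have hz0 : 0 ≤ ‖z‖ := norm_nonneg z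
  calc ‖coeff (n + 6) V.formalLog‖ * ‖z‖ ^ (n + 6) ≤ (p : ℝ) ^ n * ‖z‖ ^ (n + 6) := by
        gcongr; exact hc.trans (norm_inv_natCast_add_six_le_padic hp5 n)
    _ = ((p : ℝ) ^ n * ‖z‖ ^ n) * ‖z‖ ^ 6 := by ring
    _ ≤ ((p : ℝ) ^ n * ((p : ℝ)⁻¹) ^ n) * ‖z‖ ^ 6 := by gcongr
    _ = ‖z‖ ^ 6 := by rw [← mul_pow, mul_inv_cancel₀ hp0.ne', one_pow, one_mul]

/-- **`log_W(z) = z + ½a₁z² + ⅓(a₁²+a₂)z³ + ¼(a₁³+2a₁a₂+2a₃)z⁴ + ⅕(a₁⁴+3a₁²a₂+a₂²+6a₁a₃+2a₄)z⁵ + O(‖z‖⁶)`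
on `‖z‖_p ≤ p⁻¹`, `p ≥ 5`.** [cite: SilvermanAEC2009, IV.5.5, IV.6.4] -/
theorem norm_padicFormalLog_sub_quintic_le_padic (hp5 : 5 ≤ p) {z : ℚ_[p]} (hz : ‖z‖ ≤ (p : ℝ)⁻¹) :
    ‖V.padicFormalLog z - (z + (2 : ℚ_[p])⁻¹ * V.a₁ * z ^ 2 + (3 : ℚ_[p])⁻¹ * (V.a₁ ^ 2 + V.a₂) * z ^ 3 +
        (4 : ℚ_[p])⁻¹ * (V.a₁ ^ 3 + 2 * V.a₁ * V.a₂ + 2 * V.a₃) * z ^ 4 +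
        (5 : ℚ_[p])⁻¹ * (V.a₁ ^ 4 + 3 * V.a₁ ^ 2 * V.a₂ + V.a₂ ^ 2 + 6 * V.a₁ * V.a₃ + 2 * V.a₄) * z ^ 5)‖
      ≤ ‖z‖ ^ 6 := by
  have hp1 : (1 : ℝ) < p := by exact_mod_cast hp.out.one_lt
  have hs := V.summable_formalLog_of_isIntegral z (hz.trans_lt (inv_lt_one_of_one_lt₀ hp1))
  have hsplit := hs.sum_add_tsum_nat_add 6
  have h0 : coeff 0 V.formalLog = 0 := by rw [coeff_zero_eq_constantCoeff]; exact V.constantCoeff_formalLog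
  have h2 : coeff 2 V.formalLog = (2 : ℚ_[p])⁻¹ * V.a₁ := by
    rw [(coeff_two_formalLog V), eq_ratCast]; push_cast; ring
  have h3 : coeff 3 V.formalLog = (3 : ℚ_[p])⁻¹ * (V.a₁ ^ 2 + V.a₂) := by
    rw [(coeff_three_formalLog V), eq_ratCast]; push_cast; ring
  have h4 : coeff 4 V.formalLog = (4 : ℚ_[p])⁻¹ * (V.a₁ ^ 3 + 2 * V.a₁ * V.a₂ + 2 * V.a₃) := by
    rw [(coeff_four_formalLog V), eq_ratCast]; push_cast; ring
  have h5 : coeff 5 V.formalLog =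
      (5 : ℚ_[p])⁻¹ * (V.a₁ ^ 4 + 3 * V.a₁ ^ 2 * V.a₂ + V.a₂ ^ 2 + 6 * V.a₁ * V.a₃ + 2 * V.a₄) := by
    rw [(coeff_five_formalLog V), eq_ratCast]; push_cast; ring
  have hsix : ∑ i ∈ Finset.range 6, coeff i V.formalLog * z ^ i =
      z + (2 : ℚ_[p])⁻¹ * V.a₁ * z ^ 2 + (3 : ℚ_[p])⁻¹ * (V.a₁ ^ 2 + V.a₂) * z ^ 3 +
        (4 : ℚ_[p])⁻¹ * (V.a₁ ^ 3 + 2 * V.a₁ * V.a₂ + 2 * V.a₃) * z ^ 4 +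
        (5 : ℚ_[p])⁻¹ * (V.a₁ ^ 4 + 3 * V.a₁ ^ 2 * V.a₂ + V.a₂ ^ 2 + 6 * V.a₁ * V.a₃ + 2 * V.a₄) * z ^ 5 := by
    simp only [Finset.sum_range_succ, Finset.sum_range_zero, h0, V.coeff_one_formalLog, h2, h3, h4, h5]
    ring
  rw [WeierstrassCurve.padicFormalLog, ← hsplit, hsix, add_sub_cancel_left]
  exact IsUltrametricDist.norm_tsum_le_of_forall_le_of_nonneg (by positivity) fun n ↦
    norm_formalLog_term_le_pow_six_padic V hp5 hz n

end FormalLog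

end Summit.BirchSwinnertonDyer.Rank1Residual.X11b.RegMult.HeightLogNumerator

end
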